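import Literature.Computability.AlgebraicComplexity.MultiplicityObstructionsProofs
import Literature.NumberTheory.DiophantineGeometry.GLHighestWeightMultiplicityProofs
import Mathlib.LinearAlgebra.Matrix.MvPolynomial
import Mathlib.LinearAlgebra.Matrix.Adjugate
import Mathlib.LinearAlgebra.Matrix.NonsingularInverse
import HarnessLib

/-!
# The coordinate-ring representations `k[Sym^m (k^σ)]` and `k[Δ_m[f]]` are rational

Topic `Literature/Computability/AlgebraicComplexity`; theorems only, no definitions. Companion of
`MultiplicityObstructionsProofs.lean` (which shows that the degree pieces of `k[Sym^m]`, twisted by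
the inverse transpose, are POLYNOMIAL representations, and deduces complete reducibility).

The representation-theoretic facts of `Literature/NumberTheory/DiophantineGeometry/GLHighestWeight.lean`
(existence of highest-weight vectors `exists_hasHighestWeight_of_finiteDimensional`, the theorem of
the highest weight, `hwMultiplicity_eq_finrank_intertwiningMap`, and the extension lemma
`exists_intertwiningMap_apply_eq` of `GLHighestWeightMultiplicityProofs.lean`) are stated for
RATIONAL representations of the abstract group `GL σ k` (`IsRationalRep`: every matrix coefficient
is `P(g) / det(g)^r`). This file proves that the representations of geometric complexity theory
built in `OrbitCoordinateRing.lean` / `GCTObstructions.lean` are rational, so that those facts apply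
to them:

* `isRationalRep_coordRep` — `k[Sym^m (k^σ)]` with `(g · F)(v) = F(g⁻¹ · v)` (`coordRep`);
* `isRationalRep_orbitCoordRep` — the coordinate ring `k[Δ_m[f]] = k[Sym^m] ⧸ I(GL · f)` of an
  orbit closure (`orbitCoordRep`), an equivariant quotient (`isRationalRep_of_surjective`);
* `isRationalRep_orbitCoordRepDeg` — its degree pieces `k[Δ_m[f]]_d` (`orbitCoordRepDeg`).

Mechanism (Bläser–Ikenmeyer, *Introduction to GCT*, Example 11.2 with (9.1): the coordinate
functions of the substitution action are polynomial; Goodman–Wallach §1.5: regular functions on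
`GL_n` are generated by the matrix entries and `det⁻¹`): a matrix coefficient `φ(g · F)` is a
polynomial `Q` in the entries of `g⁻¹` (`exists_apply_coordSubst_eq_eval_inv`, by specialising the
generic substitution over `k[Mat_σ]`, `map_eval_aeval_genericSubst_matrix`), and
`g⁻¹ = det(g)⁻¹ adj(g)` with `Q = ∑_{n ≤ N} Q_n` homogeneous gives
`Q(g⁻¹) det(g)^N = ∑_n det(g)^{N-n} Q_n(adj g)`, a polynomial in the entries of `g`
(`isRationalRep_of_forall_exists_eval_inv`).

## References

* M. Bläser, C. Ikenmeyer, *Introduction to Geometric Complexity Theory*, Theory of Computing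
  Graduate Surveys 10 (2025): (9.1), Example 11.2, Prop. 3.21. [BlaeserIkenmeyer2025]
* R. Goodman, N. Wallach, *Symmetry, Representations, and Invariants*, GTM 255, §1.5.
  [GoodmanWallachGTM255]

## Mathlib and tree

Mathlib: `Matrix.mvPolynomialX`, `Matrix.mvPolynomialX_mapMatrix_eval`, `RingHom.map_adjugate`,
`RingHom.map_det`, `Matrix.inv_def`, `Matrix.coe_units_inv`, `MvPolynomial.eval₂Hom_bind₁`,
`sum_homogeneousComponent`. Tree: `coordRep`, `coordSubst`, `orbitCoordRep`, `orbitCoordSubrep`,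
`orbitCoordRepDeg` (`OrbitCoordinateRing`, `GCTObstructions`), `linSubst`, `map_linSubst`
(`MultiplicityObstructionsProofs`), `eval_smul_of_isHomogeneous` (`OrbitClosureProofs`),
`IsRationalRep`, `IsRationalRep.toRepresentation` (`GLHighestWeight`, `GLHighestWeightMultiplicityProofs`).

## Design

`[LinearOrder σ]` (not merely `[DecidableEq σ]`) because `IsRationalRep` is stated over the ordered
variable type of `GLHighestWeight.lean`; the instances agree with those of the tree's matrix space
`MatIdx m`. No definitions are introduced (the generic substitution is written inline, as in
`MultiplicityObstructionsProofs.lean`).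
-/

noncomputable section

open scoped BigOperators Matrix

namespace Literature.Computability.AlgebraicComplexity

open MvPolynomial Literature.NumberTheory.DiophantineGeometry

/-! ### Matrix coefficients of `k[Sym^m]` are polynomials in the entries of `g⁻¹` -/

section AntiPolynomial

variable {σ : Type*} [Fintype σ] [LinearOrder σ] {k : Type*} [Field k]

/-- **Specialisation of the generic substitution at an arbitrary matrix.** With the generic matrix
`Y = (X_{(i,j)})` over `k[Mat_σ]` (Mathlib `Matrix.mvPolynomialX`), substituting
`X_d ↦ ∑_e coeff_d (Y · X^e) X_e` in a polynomial function `F` on `Sym^m` and then evaluating the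
coefficients at the entries of a matrix `A` is substituting `X_d ↦ ∑_e coeff_d (A · X^e) X_e`
(the untransposed twin of `map_eval_aeval_genericSubst`). Bläser–Ikenmeyer, *Introduction to
GCT*, Prop. 3.21 / Example 11.2 (coordinate functions of the action are polynomial). [folklore] -/
theorem map_eval_aeval_genericSubst_matrix (m : ℕ) (A : Matrix σ σ k)
    (F : MvPolynomial (DegIdx σ m) k) :
    map (eval fun ij : σ × σ => A ij.1 ij.2)
      (aeval (fun d : DegIdx σ m => ∑ e : DegIdx σ m,
        C (coeff d.1 (linSubst σ (MvPolynomial (σ × σ) k) (Matrix.mvPolynomialX σ σ k)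
          (monomial e.1 1))) * X e) F) =
      aeval (fun d : DegIdx σ m => ∑ e : DegIdx σ m,
        coeff d.1 (linSubst σ k A (monomial e.1 1)) • X e) F := by
  set ev : MvPolynomial (σ × σ) k →+* k := eval fun ij : σ × σ => A ij.1 ij.2 with hev
  have hY : (Matrix.mvPolynomialX σ σ k).map ev = A := by
    ext i j
    simp [hev, Matrix.map_apply]
  have hq : ∀ d e : DegIdx σ m,
      ev (coeff d.1 (linSubst σ (MvPolynomial (σ × σ) k) (Matrix.mvPolynomialX σ σ k)
        (monomial e.1 1))) = coeff d.1 (linSubst σ k A (monomial e.1 1)) := by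
    intro d e
    rw [← coeff_map, map_linSubst, hY, map_monomial, map_one]
  suffices h : (map ev).comp (aeval (fun d : DegIdx σ m => ∑ e : DegIdx σ m,
        C (coeff d.1 (linSubst σ (MvPolynomial (σ × σ) k) (Matrix.mvPolynomialX σ σ k)
          (monomial e.1 1))) * X e)).toRingHom =
      (aeval (fun d : DegIdx σ m => ∑ e : DegIdx σ m,
        coeff d.1 (linSubst σ k A (monomial e.1 1)) • X e) :
          MvPolynomial (DegIdx σ m) k →ₐ[k] MvPolynomial (DegIdx σ m) k).toRingHom from
    RingHom.congr_fun h F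
  refine MvPolynomial.ringHom_ext (fun c => ?_) (fun d => ?_)
  · simp only [RingHom.comp_apply, AlgHom.toRingHom_eq_coe, RingHom.coe_coe, aeval_C,
      MvPolynomial.algebraMap_apply, MvPolynomial.algebraMap_eq, map_C, hev, eval_C]
  · simp only [RingHom.comp_apply, AlgHom.toRingHom_eq_coe, RingHom.coe_coe, aeval_X, map_sum,
      map_mul, map_C, map_X, hq, smul_eq_C_mul]

/-- **Matrix coefficients of `k[Sym^m (k^σ)]` are polynomials in the entries of `g⁻¹`.** For
every polynomial function `F` on `Sym^m` and every linear functional `φ` on `k[Sym^m]` there is a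
polynomial `Q ∈ k[Mat_σ]` with `φ(g · F) = Q(g⁻¹)` for all `g ∈ GL σ k` (the action
`(g · F)(v) = F(g⁻¹ · v)` substitutes through `g⁻¹`, `coordSubst`). Bläser–Ikenmeyer Example 11.2
(for the inverse-free action (9.1)); here in the convention of `OrbitCoordinateRing.lean`. [folklore] -/
theorem exists_apply_coordSubst_eq_eval_inv (m : ℕ) (F : MvPolynomial (DegIdx σ m) k)
    (φ : Module.Dual k (MvPolynomial (DegIdx σ m) k)) :
    ∃ Q : MvPolynomial (σ × σ) k, ∀ g : GL σ k,
      φ (coordSubst m g F) =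
        eval (fun ij : σ × σ => ((g⁻¹ : GL σ k) : Matrix σ σ k) ij.1 ij.2) Q := by
  classical
  -- the generic substitution applied to `F`
  set G : MvPolynomial (DegIdx σ m) (MvPolynomial (σ × σ) k) :=
    aeval (fun d : DegIdx σ m => ∑ e : DegIdx σ m,
      C (coeff d.1 (linSubst σ (MvPolynomial (σ × σ) k) (Matrix.mvPolynomialX σ σ k)
        (monomial e.1 1))) * X e) F with hG
  refine ⟨∑ u ∈ G.support, coeff u G * C (φ (monomial u 1)), fun g => ?_⟩
  set A : Matrix σ σ k := ((g⁻¹ : GL σ k) : Matrix σ σ k) with hA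
  have hsub : coordSubst m g F = aeval (fun d : DegIdx σ m => ∑ e : DegIdx σ m,
      coeff d.1 (linSubst σ k A (monomial e.1 1)) • X e) F := rfl
  rw [hsub, ← map_eval_aeval_genericSubst_matrix m A F]
  set ev : MvPolynomial (σ × σ) k →+* k := eval fun ij : σ × σ => A ij.1 ij.2 with hev
  show φ (map ev G) = ev (∑ u ∈ G.support, coeff u G * C (φ (monomial u 1)))
  conv_lhs => rw [G.as_sum, map_sum]
  rw [map_sum, map_sum]
  refine Finset.sum_congr rfl fun u _ => ?_
  rw [map_monomial, map_mul, eval_C]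
  have : (monomial u (ev (coeff u G)) : MvPolynomial (DegIdx σ m) k) =
      ev (coeff u G) • monomial u 1 := by
    rw [smul_monomial, smul_eq_mul, mul_one]
  rw [this, map_smul, smul_eq_mul]

/-- **Polynomial in `g⁻¹` implies rational.** If every matrix coefficient of a representation `ρ`
of `GL σ k` is a polynomial `Q` in the entries of `g⁻¹`, then `ρ` is rational: writing
`g⁻¹ = det(g)⁻¹ adj(g)` and `Q = ∑_{n ≤ N} Q_n` in homogeneous components,
`Q(g⁻¹) · det(g)^N = ∑_n det(g)^{N-n} Q_n(adj g)` is a polynomial in the entries of `g`.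
Goodman–Wallach §1.5 (regular functions on `GL_n` are `k[x_{ij}, det⁻¹]`). [folklore] -/
theorem isRationalRep_of_forall_exists_eval_inv {V : Type*} [AddCommGroup V] [Module k V]
    {ρ : Representation k (GL σ k) V}
    (h : ∀ (v : V) (φ : Module.Dual k V), ∃ Q : MvPolynomial (σ × σ) k, ∀ g : GL σ k,
      φ (ρ g v) = eval (fun ij : σ × σ => ((g⁻¹ : GL σ k) : Matrix σ σ k) ij.1 ij.2) Q) :
    IsRationalRep ρ := by
  classical
  intro v φ
  obtain ⟨Q, hQ⟩ := h v φ
  set N : ℕ := Q.totalDegree with hN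
  set Y : Matrix σ σ (MvPolynomial (σ × σ) k) := Matrix.mvPolynomialX σ σ k with hY
  refine ⟨∑ n ∈ Finset.range (N + 1), Y.det ^ (N - n) *
      bind₁ (fun ij : σ × σ => Y.adjugate ij.1 ij.2) (homogeneousComponent n Q), N, fun g => ?_⟩
  set e : σ × σ → k := fun ij => (g : Matrix σ σ k) ij.1 ij.2 with he
  set c : k := (g : Matrix σ σ k).det with hc
  set B : Matrix σ σ k := (g : Matrix σ σ k).adjugate with hB
  have hc0 : c ≠ 0 := by
    rw [hc]
    exact (Matrix.isUnits_det_units g).ne_zero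
  -- the entries of `g⁻¹`
  have hinv : (fun ij : σ × σ => ((g⁻¹ : GL σ k) : Matrix σ σ k) ij.1 ij.2) =
      c⁻¹ • fun ij : σ × σ => B ij.1 ij.2 := by
    funext ij
    rw [Matrix.coe_units_inv, Matrix.inv_def, Ring.inverse_eq_inv']
    rfl
  -- evaluation of the generic determinant and adjugate at `g`
  have hYe : (eval e).mapMatrix Y = (g : Matrix σ σ k) := Matrix.mvPolynomialX_mapMatrix_eval _
  have hdet : eval e Y.det = c := by
    rw [RingHom.map_det, hYe]
  have hadj : ∀ ij : σ × σ, eval e (Y.adjugate ij.1 ij.2) = B ij.1 ij.2 := by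
    intro ij
    have h1 := RingHom.map_adjugate (eval e) Y
    rw [hYe] at h1
    have h2 := congrFun (congrFun h1 ij.1) ij.2
    rw [RingHom.mapMatrix_apply, Matrix.map_apply] at h2
    exact h2
  -- compute
  rw [hQ g, hinv, map_sum]
  conv_lhs => rw [← sum_homogeneousComponent Q, map_sum, Finset.sum_mul]
  refine Finset.sum_congr rfl fun n hn => ?_
  have hnN : n ≤ N := Nat.lt_succ_iff.mp (Finset.mem_range.mp hn)
  rw [eval_smul_of_isHomogeneous (homogeneousComponent_isHomogeneous n Q), map_mul, map_pow, hdet,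
    show eval e (bind₁ (fun ij : σ × σ => Y.adjugate ij.1 ij.2) (homogeneousComponent n Q)) =
      eval (fun ij : σ × σ => B ij.1 ij.2) (homogeneousComponent n Q) by
        change eval₂Hom (RingHom.id k) e (bind₁ _ _) = _
        rw [eval₂Hom_bind₁]
        change eval (fun ij : σ × σ => eval e (Y.adjugate ij.1 ij.2)) _ = _
        simp only [hadj]]
  rw [inv_pow, mul_assoc, mul_comm (eval _ _) (c ^ N), ← mul_assoc, pow_sub₀ c hc0 hnN]
  ring

/-- **`k[Sym^m (k^σ)]` is a rational representation of `GL σ k`** (`coordRep`, the action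
`(g · F)(v) = F(g⁻¹ · v)` on polynomial functions on forms of degree `m`): its matrix coefficients
are polynomials in the entries of `g⁻¹ = det(g)⁻¹ adj(g)`. Goodman–Wallach §1.5; Bläser–Ikenmeyer
Example 11.2. [folklore] -/
theorem isRationalRep_coordRep (m : ℕ) : IsRationalRep (coordRep σ k m) :=
  isRationalRep_of_forall_exists_eval_inv fun F φ => exists_apply_coordSubst_eq_eval_inv m F φ

/-- A `GL`-equivariant quotient of a rational representation is rational (matrix coefficients of
the quotient are matrix coefficients of the source: `φ(ρ'(g) π v) = (φ ∘ π)(ρ(g) v)`).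
Goodman–Wallach §1.5. [folklore] -/
theorem isRationalRep_of_surjective {V W : Type*} [AddCommGroup V] [Module k V] [AddCommGroup W]
    [Module k W] {ρ : Representation k (GL σ k) V} {ρ' : Representation k (GL σ k) W}
    (π : ρ.IntertwiningMap ρ') (hπ : Function.Surjective π) (h : IsRationalRep ρ) :
    IsRationalRep ρ' := by
  intro w φ
  obtain ⟨v, rfl⟩ := hπ w
  obtain ⟨P, r, hP⟩ := h v (φ.comp π.toLinearMap)
  refine ⟨P, r, fun g => ?_⟩
  rw [← hP g, LinearMap.comp_apply, Representation.IntertwiningMap.toLinearMap_apply,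
    π.isIntertwining]

/-- **`k[Δ_m[f]]` is a rational representation of `GL σ k`** (`orbitCoordRep f m`): it is the
equivariant quotient of the rational `k[Sym^m]` by the vanishing ideal of the orbit.
Goodman–Wallach §1.5; Bürgisser–Landsberg–Manivel–Weyman 2011 §2. [folklore] -/
theorem isRationalRep_orbitCoordRep (f : MvPolynomial σ k) (m : ℕ) :
    IsRationalRep (orbitCoordRep f m) :=
  isRationalRep_of_surjective
    (⟨(Ideal.Quotient.mkₐ k (orbitVanishingIdeal f m)).toLinearMap, fun _ => LinearMap.ext fun _ => rfl⟩ :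
      (coordRep σ k m).IntertwiningMap (orbitCoordRep f m))
    (Ideal.Quotient.mkₐ_surjective k _) (isRationalRep_coordRep m)

/-- The degree pieces `k[Δ_m[f]]_d` (`orbitCoordRepDeg`) are rational representations
(subrepresentations of the rational `k[Δ_m[f]]`). [folklore] -/
theorem isRationalRep_orbitCoordRepDeg (f : MvPolynomial σ k) (m d : ℕ) :
    IsRationalRep (orbitCoordRepDeg f m d) :=
  (isRationalRep_orbitCoordRep f m).toRepresentation (orbitCoordSubrep f m d)

end AntiPolynomial

end Literature.Computability.AlgebraicComplexity

end
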